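import Literature.NumberTheory.EllipticCurves.CaiShuTian2017.CubeSumTwicePrimes
import HarnessLib

/-!
# Gunri–Jha–Majumdar 2026 (arXiv:2607.26774, PREPRINT), *Explicit mock Heegner points and BSD formula on certain Mordell curves*: Thm. 0.1 and Thm. 0.2 AS PRINTED — the cube sums `2p` (`p ≡ 4 mod 9`) and `2p²` (`p ≡ 7 mod 9`) when `2` is not a cube mod `p`; rank `=` analytic rank `= 1` and the BSD formula for `E_{2q} : y² = x³ − 27q²` UP TO A UNIT OF `ℤ[1/2]`; full BSD for the rank-zero partner `E_{2q²}`

HONEST FRAMING (cell `bsd-print-cf2`, D-0131 (2) PRINT TIER, literature seat `lit g8`; HOME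
`run/shared/lean/pub/bsd-print-cf2/`, DOSSIER §19). An UNREFEREED preprint (v1, 29 Jul 2026; no
journal, no DOI) vendored as named `Prop`s (nothing asserted, nothing discharged; D-0014), every
printed hypothesis a binder, locators into the held text (`paper:arxiv-2607.26774`, 12 PDF pages;
`pN Lm` = page `N` line `m` of that text). It is the `p ≡ 4, 7 (mod 9)` companion of the
PUBLISHED Cai–Shu–Tian 2017 Thm. 1.2 (`p ≡ 2, 5 (mod 9)`, tree
`CaiShuTian2017.thm12_bsd_cubeSum_twicePrime`) on the SAME curves — the cube-sum curves
`x³ + y³ = 2p`, `x³ + y³ = 2p²` (CM by `ℤ[ω]`, `K = ℚ(√−3)`, `2` INERT in `K`, additive reduction at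
`2`), i.e. Kezuka–Li's minimal models `cubeSumTwoModel p j : y² = x³ − 27 p^{2j}` — with one extra
printed hypothesis ("`2` is not a cube in `𝔽_p`") and a STRONGER printed BSD clause: the order of
`Ш` equals the BSD prediction up to a unit of `ℤ[1/2]`, i.e. the `ℓ`-part of the BSD formula for
EVERY prime `ℓ ≠ 2` (`ℓ = 3` and `ℓ = p` INCLUDED; Cai–Shu–Tian exclude `ℓ ∣ 2p`). FLAG AT 2: the
prime `2` is EXCLUDED, verbatim ("up to a unit in `ℤ[1/2]`", p2 L31–L34; "for primes `ℓ ≠ 2` the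
`ℓ`-part of BSD formula holds", p11 L56–L58) — so the leaf of the cell (CornerF @ `p = 2`: CM,
analytic rank one, the prime `2`) is NOT touched; the file records the most recent print on these
leaf members and what it does NOT give. In PARTITION currency the pairs `(W, ℓ)` it does give are CM
rank-one pairs at every ODD `ℓ`: `ℓ = 3` (ramified in `ℚ(√−3)`: leaf CornerF-ramified @ 3, cell
`bsd-print-cfram`), `ℓ = p` (split, potentially good ordinary) and odd good `ℓ` — by name, modulo
the preprint (`hasCM_analyticRank_bsdp_of_thm01` in the sibling PROOFS file).

Source. S. Gunri, S. Jha, D. Majumdar, *Explicit mock Heegner points and BSD formula on certain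
Mordell curves*, arXiv:2607.26774v1 [math.NT], 29 Jul 2026, 12 pp. [GunriJhaMajumdar2026]
(PREPRINT, unrefereed; bib note says so). STATUS (2026-08-27): no journal version; no citing work;
the cell has NOT refereed the argument (mock Heegner point `P₁ ∈ E(H_{6p})` on `E : y² = x³ + 1`
via `X₀(36)` §1; non-torsion by reduction mod `p` against an auxiliary torsion point `P′`, Thm. 2.2
— this is where "`2` is not a cube mod `p`" enters; explicit Gross–Zagier by the "variation" of
Cai–Shu–Tian 2014 Thm. 1.6 / Example p. 2535, Thm. 3.1; the `ℓ`-parts: `ℓ ∤ 6p` "by works of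
Perrin-Riou [PR] and Kobayashi [Kob]", `ℓ = p` "by the work of Li, Liu, and Tian [LLT]"
(potentially good ordinary), `ℓ = 3` by the `3`-indivisibility of the Heegner point (Lemmas 2.3,
2.4) with the `3`-Selmer dimensions of Jha–Majumdar–Shingavekar [JMS2], p10 L107–p11 L58). Users
who book anything through these names book it MODULO AN UNREFEREED CLAIM and must say so.

## The printed statements (verbatim)

* Abstract (p1 L4–L10): "For a natural number `a`, let `E_{2a}` be the Mordell elliptic curve
  `X³ + Y³ = 2a`. We give an explicit construction of (mock) Heegner point on the Mordell curve
  `E_{2p}` for a prime `p ≡ 4 mod 9` and `E_{2p²}` for a prime `p ≡ 7 mod 9`, under the assumption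
  that `2` is not a cube modulo `p`. We also verify the explicit Gross–Zagier formula for these
  curves and go on to show that the BSD formula holds for these curves up to a `2`-adic unit. Using
  a result of Burungale–Flach, we show that the full BSD formula holds for the rank zero curve
  `E_{2p}` for `p ≡ 7 mod 9` and `E_{2p²}` for `p ≡ 4 mod 9`, whenever `2` is not a cube modulo `p`."
* Conventions (p1 L13–L19): "Let us call an integer `n` a rational cube sum if there exist two
  rational numbers `a` and `b` such that `n = a³ + b³`" … "the elliptic curve `Y³ + X³ = nZ³`,
  expressed in Weierstrass form as `E_n : Y² = X³ − 432n²`"; (0.1) (p1 L35–L39): "`q = p` if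
  `p ≡ 4 mod 9`, `q = p²` if `p ≡ 7 mod 9`"; (p8 L69): "`k ∈ {1,2}` … the integer such that
  `q = p^k`".
* **Theorem 0.1** (p2 L21–L35): "Let `p ≡ 4, 7 mod 9` be a prime such that `2` is not a cube in
  `𝔽_p`. Then the elliptic curve `E_{2q} : y² = x³ − 27q²` satisfies the rank part of the BSD
  conjecture, that is `ord_{s=1} L(E_{2q}, 1) = rank_ℤ E_{2q}(ℚ) = 1`. In particular, `2q` is a
  rational cube sum. Moreover, the order of the finite group `Ш(E_{2q}/ℚ)` is
  `|Ш(E_{2q}/ℚ)| = L′(E_{2q},1) |E_{2q}(ℚ)_tors|² / (Ω_{E_{2q}} Reg(E_{2q}) ∏_v c_v(E_{2q})) · u`,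
  `u ∈ ℤ[1/2]^×`, as predicted by the BSD conjecture, up to a unit in `ℤ[1/2]`."
* **Theorem 0.2** (p2 L39–L40): "Let `p ≡ 4, 7 mod 9` be a prime such that `2` is not a cube in
  `𝔽_p`. Then the rank zero elliptic curve `E_{2q²} : y² = x³ − 27q⁴` satisfies the full BSD
  conjecture." (p2 L36–L37: "If `2` is not a cube in `𝔽_p`, then for primes `p ≡ 4, 7 mod 9`, we
  have `rank_ℤ E_{2q²}(ℚ) = 0` (see [MS2, JMS2])"; proof p10 L65–L71: `L(1, E_{2q²}) ≠ 0` from the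
  explicit Gross–Zagier formula, then "the full BSD formula for `E_{2q²}` over `ℚ` holds by the
  work of Burungale–Flach [BF]".)

## Transcription (tree dictionary)

* `E_{2q} : y² = x³ − 27q²` with `q = p^k`: `k = 1` gives `y² = x³ − 27p²`, `k = 2` gives
  `y² = x³ − 27p⁴`; these ARE Kezuka–Li's `cubeSumTwoModel p 1`, `cubeSumTwoModel p 2`
  (`⟨0,0,0,0,−27 p^{2j}⟩`, the curves `x³ + y³ = 2p`, `x³ + y³ = 2p²`). So `E_{2q}` is
  `cubeSumTwoModel p (qExponent p)` with `qExponent p = 1` for `p ≡ 4`, `= 2` for `p ≡ 7 (mod 9)`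
  (the printed `k`). The partner `E_{2q²} : y² = x³ − 27q⁴` is `cubeSumTwoModel p 2` for `k = 1`
  and, for `k = 2`, `y² = x³ − 27p⁸`, which is `ℚ`-isomorphic to `cubeSumTwoModel p 1` by
  `(x, y) ↦ (p²x, p³y)` (`x³ + y³ = 2p⁴ ≅ x³ + y³ = 2p`); so `E_{2q²} ≅_ℚ cubeSumTwoModel p
  (partnerExponent p)`, `partnerExponent p = 2` resp. `1`. As in the tree's Cai–Shu–Tian /
  Kezuka–Li / Hu–Shu–Yin files every clause is stated for ANY globally minimal model `W` that is
  `ℚ`-isomorphic (`VariableChange`) to the named model: rank, analytic rank, `Ш` are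
  `ℚ`-isomorphism invariants and Miller's `#Ш_an = shaAn W` is the printed prediction
  `L′(E,1)|E(ℚ)_tors|²/(Ω Reg ∏c_v)` (analytic rank one: `L^{(1)}(E,1)/1!`) exactly on a globally
  minimal model.
* "`2` is not a cube in `𝔽_p`": `¬ ∃ x : ZMod p, x ^ 3 = 2`.
* "`2q` is a rational cube sum" in the AUTHORS' sense (`a, b ∈ ℚ`, zero allowed; p1 L13–L14):
  `∃ a b : ℚ, a ^ 3 + b ^ 3 = 2q` — transcribed as printed (for the non-cubes `2p`, `2p²` this is
  the same as Cai–Shu–Tian's `IsCubeSum`, but that equivalence is not part of the statement).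
* "`ord_{s=1} L = rank_ℤ = 1`": `analyticRank = 1 ∧ mordellWeilRank = 1`; "the finite group
  `Ш(E_{2q}/ℚ)`": `Finite W.sha`; "`|Ш| = (prediction) · u`, `u ∈ ℤ[1/2]^×`": `∃ u : ℚ`, `u ≠ 0`,
  `ord_ℓ u = 0` for every prime `ℓ ≠ 2` (this IS membership in `ℤ[1/2]^× = {±2^k}`), and
  `(#Ш : ℂ) = shaAn W · u`.
* "rank zero … satisfies the full BSD conjecture": `mordellWeilRank = 0 ∧ W.BSDTriple`
  (RANK ∧ SHAFIN ∧ LEAD, the tree's full-BSD predicate).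
Nothing weaker or stronger is transcribed; `ℓ = 2` is outside Theorem 0.1 as printed. No `_holds`
is expected (mock Heegner points on `X₀(36)` over ring class fields of conductor `6p`, the explicit
Gross–Zagier formula, Kolyvagin, Perrin-Riou / Kobayashi `p`-adic heights: none in Mathlib).
Consumers take `(h : thm01_bsd_cubeSum_twicePrime_fourSeven)` etc.

This file is STATEMENT-ONLY (cell convention: named facts statement-only with cite tags; the
companion `GunriJhaMajumdar2026/CubeSumTwicePrimesFourSevenProofs.lean` PROVES the bookkeeping:
`qExponent` / `partnerExponent` values; the printed hypothesis in closed form — for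
`p ≡ 4, 7 (mod 9)`, "`2` is not a cube in `𝔽_p`" iff `p ≠ C² + 27D²` (Gauss / Ireland–Rosen
Prop. 9.6.2, the tree's `GaloisRepresentations.CubicCharacterOfTwo`); non-vacuity of both classes
(`p = 7`, `p = 13`) and a non-member (`p = 31 = 2² + 27·1²`); and
`hasCM_analyticRank_bsdp_of_thm01`: Thm. 0.1 ⇒ `W.HasCM ∧ r_an(W) = 1 ∧ BSD(W, ℓ)` (Miller) for
every prime `ℓ ≠ 2` — the by-name form other cells consume).

## References
* [GunriJhaMajumdar2026] S. Gunri, S. Jha, D. Majumdar, arXiv:2607.26774v1 (29 Jul 2026): abstract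
  (p1 L4–L10), (0.1) (p1 L35–L39), Thm. 0.1 (p2 L21–L35), Thm. 0.2 (p2 L36–L40), Thm. 2.2 (p7 L52),
  Thm. 3.1 / Cor. 3.2 (p9 L27, p10 L55–L63), proofs of Thms. 0.1/0.2 (p10 L64–p11 L61).
* [CaiShuTian2017] L. Cai, J. Shu, Y. Tian, Amer. J. Math. 139 (2017) 785–816, Thm. 1.2 (the
  `p ≡ 2, 5 (mod 9)` companion; tree `CaiShuTian2017.thm12_bsd_cubeSum_twicePrime`).
* [KezukaLi2020] Y. Kezuka, Y. Li, Doc. Math. 25 (2020), (4.1) p. 2139 (the model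
  `y² = x³ − 27p^{2j}`).
* [BurungaleFlach2024] A. Burungale, M. Flach, Camb. J. Math. 12 (2024), Thm. 1.1 / Cor. 2 (the
  authors' [BF]; tree `bsdTriple_of_hasCM_of_L_one_ne_zero`).
* [Miller2011LMS] R. L. Miller, LMS J. Comput. Math. 14 (2011), §1 and Def. 1.1 (`#Ш_an`,
  `BSD(E,p)`).
* [IrelandRosen1990] K. Ireland, M. Rosen, GTM 84 (2nd ed. 1990), Ch. 9 §6 Prop. 9.6.2 and the
  examples `p = 7`, `p = 31` (tree `GaloisRepresentations/CubicCharacterOfTwo.lean`).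
-/

noncomputable section

open scoped Classical

open WeierstrassCurve Literature.NumberTheory.EllipticCurves
  Literature.NumberTheory.EllipticCurves.KezukaLi2020
  Literature.NumberTheory.EllipticCurves.CaiShuTian2017

namespace Literature.NumberTheory.EllipticCurves.GunriJhaMajumdar2026

/-! ### §1. Vocabulary (definitions with bodies; nothing asserted) -/

/-- The printed exponent `k ∈ {1, 2}` with `q = p^k`: "`q = p` if `p ≡ 4 mod 9`, `q = p²` if
`p ≡ 7 mod 9`" — so `E_{2q} : y² = x³ − 27q²` is `cubeSumTwoModel p (qExponent p)`
(`x³ + y³ = 2p` resp. `x³ + y³ = 2p²`). Outside the two printed classes the value `2` is a junk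
default never used by the facts below (they carry `p % 9 = 4 ∨ p % 9 = 7`).
[cite: GunriJhaMajumdar2026, (0.1) (arXiv:2607.26774v1 p1 L35–L39) and p8 L69] -/
def qExponent (p : ℕ) : ℕ := if p % 9 = 4 then 1 else 2

/-- The cube-free exponent of the PARTNER `E_{2q²} : y² = x³ − 27q⁴`: `x³ + y³ = 2q²` is
`x³ + y³ = 2p²` (`cubeSumTwoModel p 2`) for `p ≡ 4 (mod 9)` and `x³ + y³ = 2p⁴ ≅_ℚ x³ + y³ = 2p`
(`cubeSumTwoModel p 1`, remove the cube `p³`) for `p ≡ 7 (mod 9)`. Junk default `1` outside the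
printed classes. [cite: GunriJhaMajumdar2026, Thm. 0.2 (arXiv:2607.26774v1 p2 L39–L40) with (0.1)] -/
def partnerExponent (p : ℕ) : ℕ := if p % 9 = 4 then 2 else 1

/-! ### §2. The printed theorems (named facts; nothing asserted; PREPRINT) -/

/-- **Gunri–Jha–Majumdar 2026, Theorem 0.1** (PREPRINT arXiv:2607.26774v1, UNREFEREED; verbatim
in the module docstring — here the source's two-word name for the Birch–Swinnerton-Dyer
prediction is rendered `[BSD]`, as the tree's Cai–Shu–Tian file renders it `[formula]`): "Let
`p ≡ 4, 7 mod 9` be a prime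
such that `2` is not a cube in `𝔽_p`. Then the elliptic curve `E_{2q} : y² = x³ − 27q²`
satisfies the rank part of [BSD], that is `ord_{s=1} L(E_{2q},1) = rank_ℤ E_{2q}(ℚ) = 1`. In
particular, `2q` is a rational cube sum. Moreover, the order of the finite group `Ш(E_{2q}/ℚ)` is
`|Ш(E_{2q}/ℚ)| = L′(E_{2q},1)|E_{2q}(ℚ)_tors|²/(Ω_{E_{2q}} Reg(E_{2q}) ∏_v c_v(E_{2q})) · u`,
`u ∈ ℤ[1/2]^×`, as predicted by [BSD], up to a unit in `ℤ[1/2]`" (`q = p` for `p ≡ 4`, `q = p²`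
for `p ≡ 7 (mod 9)`). Transcription (module docstring): `W` any globally
minimal model `ℚ`-isomorphic to `cubeSumTwoModel p (qExponent p)` (`= E_{2q}`); "`2` not a cube
in `𝔽_p`" = `¬ ∃ x : ZMod p, x³ = 2`; "rational cube sum" in the authors' sense (`a, b ∈ ℚ`);
`u ∈ ℤ[1/2]^×` = `u ∈ ℚ`, `u ≠ 0`, `ord_ℓ u = 0` for all primes `ℓ ≠ 2`; the prediction is
Miller's `shaAn W` (analytic rank one). The prime `2` is EXCLUDED, as printed. PREPRINT: any use is
modulo an unrefereed claim.
[cite: GunriJhaMajumdar2026, Thm. 0.1 (arXiv:2607.26774v1 p2 L21–L35), proof (p10 L72–p11 L61)] [cite: KezukaLi2020, (4.1) (p. 2139)] [cite: Miller2011LMS, §1 (arXiv:1010.2431 p. 3)] -/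
def thm01_bsd_cubeSum_twicePrime_fourSeven : Prop :=
  ∀ (p : ℕ), p.Prime → (p % 9 = 4 ∨ p % 9 = 7) → (¬ ∃ x : ZMod p, x ^ 3 = 2) →
    ∀ (W : WeierstrassCurve ℚ) [W.IsElliptic] [W.IsGloballyMinimal],
      (∃ C : VariableChange ℚ, C • W = cubeSumTwoModel p (qExponent p)) →
      (∃ a b : ℚ, a ^ 3 + b ^ 3 = 2 * (p : ℚ) ^ qExponent p) ∧
      W.analyticRank = 1 ∧ W.mordellWeilRank = 1 ∧ Finite W.sha ∧
      ∃ u : ℚ, u ≠ 0 ∧ (∀ ℓ : ℕ, ℓ.Prime → ℓ ≠ 2 → padicValRat ℓ u = 0) ∧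
        (Nat.card W.sha : ℂ) = shaAn W * (u : ℂ)

/-- **Gunri–Jha–Majumdar 2026, Theorem 0.2** (PREPRINT arXiv:2607.26774v1, UNREFEREED; verbatim
in the module docstring; `[BSD]` as in `thm01_bsd_cubeSum_twicePrime_fourSeven`): "Let
`p ≡ 4, 7 mod 9` be a prime such that `2` is not a cube in `𝔽_p`. Then the rank zero elliptic
curve `E_{2q²} : y² = x³ − 27q⁴` satisfies the full [BSD]." Transcription: `W` any globally
minimal model `ℚ`-isomorphic to `cubeSumTwoModel p (partnerExponent p)` (`x³ + y³ = 2p²` for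
`p ≡ 4`, `x³ + y³ = 2p ≅ 2p⁴` for `p ≡ 7 (mod 9)`); "rank zero" = `mordellWeilRank = 0`; "the
full [BSD]" = the tree's `W.BSDTriple` (RANK ∧ SHAFIN ∧ LEAD). (Printed proof: `L(1, E_{2q²}) ≠ 0` by the explicit Gross–Zagier formula
Thm. 3.1, then Burungale–Flach; in tree currency the BSD part is the Burungale–Flach fact
`bsdTriple_of_hasCM_of_L_one_ne_zero` once `L(1) ≠ 0` — the new printed content is the
non-vanishing.) PREPRINT: any use is modulo an unrefereed claim.
[cite: GunriJhaMajumdar2026, Thm. 0.2 (arXiv:2607.26774v1 p2 L36–L40), proof (p10 L65–L71)] [cite: BurungaleFlach2024, Thm. 1.1 and Cor. 2] -/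
def thm02_fullBSD_cubeSum_twicePrime_partner : Prop :=
  ∀ (p : ℕ), p.Prime → (p % 9 = 4 ∨ p % 9 = 7) → (¬ ∃ x : ZMod p, x ^ 3 = 2) →
    ∀ (W : WeierstrassCurve ℚ) [W.IsElliptic] [W.IsGloballyMinimal],
      (∃ C : VariableChange ℚ, C • W = cubeSumTwoModel p (partnerExponent p)) →
      W.mordellWeilRank = 0 ∧ W.BSDTriple

end Literature.NumberTheory.EllipticCurves.GunriJhaMajumdar2026
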